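import Summits.AtomisticToContinuum.HydrodynamicLimit.Theses.InformationPercolationEngine

/-!
# Necklace probe: Chebyshev floor and Donsker–Varadhan bookkeeping lemmas (negative helper, crux `PercolationClosesChaos`, stmt-AtomisticToContinuum-15178) — rev 3, WITH A RETRACTION

Refuter material for the rev-12 line `Sketch` (card ergodic-window-is-von-neumann) — `Cruxes/PercolationClosesChaos/Disproof.lean`
§13–§14, findings F20 (retracted floor) and F21 (surviving obstruction: a fast single-pulse necklace burst gives
`P_{G_N}(K_N[|v_i|²+|v_j|²] ≥ K₀) ≥ exp(−√(2c₁K₀/σ)(N+1)^{2/3}(1+o(1)))`, so no speed-N transfer can deliver the energy part of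
`CollisionMomentBound`, stmt-15144). Revs 1–2 of this file (p109473, p109726) narrated an `N`-uniform floor for the
collision-weighted DV transfer of `stub_dvTransfer`; that narrative is RETRACTED below (Euler buckling of the loaded chain makes a
horizon-long necklace super-extensively expensive). All declarations of revs 1–2 are kept verbatim; they are correct abstract
statements. No statement of the route is asserted.


What stays: the kernel-checked lemmas below are correct abstract statements — Chebyshev for exponential moments
(`exp_mul_measureReal_le_integral_exp`, used by F21) and the Donsker–Varadhan bookkeeping of a HYPOTHETICAL event family of
extensive cost `P(B ≥ x) ≥ e^{−(N+1)(a x² + b x)}` (`quadraticCost_sup_attained`, `dv_choice_void`, `dv_bound_floor`,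
`necklace_term_ge`, `dv_floor_two_branch`: such a family would cap the DV-certifiable bound below by `min(h/(2b), ½√(h/a))`).
What is RETRACTED (versions 1–2, 14:40–14:55Z): that wrapped necklaces ARE such a family for the window-averaged
collision-weighted bad fraction `B` of `KineticCellChaosLG`. They are not: the transverse dynamics of a chain loaded by a momentum
flux is Euler buckling — a passage kicks ball `j`'s transverse velocity by `−(v/ε)(Ly)_j` and kicks accumulate, so the staggered
mode grows by `e^{√(8g/ε)}` per passage (not `1 + 4g/ε`), the stability exponent over a lifetime `τ'` is
`E_s ≈ 2√2 vτ'√(j/(Gε))`, and holding `B ≥ x` over the horizon costs `≥ c₁√2 π x τ σ^{5/2}(N+1)^{7/6}` in alignment precision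
whatever `v, τ', j, G` (bursts are diluted by `W⁻¹Σ_w` and cost `≍ N^{5/3}`): SUPER-EXTENSIVE, no floor. The DV transfer's hidden
input (F18 d) is therefore NOT refuted by necklaces. The probe pays off elsewhere: §14 / F21. -/


noncomputable section

open MeasureTheory

namespace Summit.AtomisticToContinuum.HydrodynamicLimit.Theorems.PercolationClosesChaos.Negative


/-- **Chebyshev for exponential moments** (the step turning a cheap tail event into a floor of the log-moment generating
function): for `0 < t`, `exp(t x) · μ{x ≤ B} ≤ ∫ exp(t B) dμ`. [folklore] -/
theorem exp_mul_measureReal_le_integral_exp {Ω : Type*} [MeasurableSpace Ω] (μ : Measure Ω) {B : Ω → ℝ} {t : ℝ}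
    (ht : 0 < t) (hint : Integrable (fun ω => Real.exp (t * B ω)) μ) (x : ℝ) :
    Real.exp (t * x) * μ.real {ω | x ≤ B ω} ≤ ∫ ω, Real.exp (t * B ω) ∂μ := by
  have hset : {ω | Real.exp (t * x) ≤ Real.exp (t * B ω)} = {ω | x ≤ B ω} := by
    ext ω
    simp only [Set.mem_setOf_eq, Real.exp_le_exp]
    exact mul_le_mul_iff_of_pos_left ht
  have h := mul_meas_ge_le_integral_of_nonneg (Filter.Eventually.of_forall fun ω => (Real.exp_pos (t * B ω)).le)
    hint (Real.exp (t * x))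
  rwa [hset] at h

/-- **The quadratic-cost supremum**: `sup_x ((λ − b) x − a x²) ≥ (λ − b)²/(4a)`, attained at `x⋆ = (λ − b)/(2a)`. [folklore] -/
theorem quadraticCost_sup_attained {a b lam : ℝ} (ha : 0 < a) :
    (lam - b) * ((lam - b) / (2 * a)) - a * ((lam - b) / (2 * a)) ^ 2 = (lam - b) ^ 2 / (4 * a) := by
  field_simp
  ring

/-- **DV bookkeeping, hypothetical extensive-cost family** (`P(B ≥ x) ≥ e^{−(N+1)(ax²+bx)}`; NO instance on this crux after the
retraction of F20): with per-particle entropy budget `K`, the choice `λ = 2K/δ` would require `(λ − b)²/(4a) ≤ K`, which fails for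
every `δ² < K/(4a)` (and `b ≤ K/δ`). [folklore] -/
theorem dv_choice_void {a b K δ : ℝ} (ha : 0 < a) (hK : 0 < K) (hδ : 0 < δ) (hb : b ≤ K / δ)
    (hsmall : δ ^ 2 < K / (4 * a)) : K < (2 * K / δ - b) ^ 2 / (4 * a) := by
  have h1 : K / δ ≤ 2 * K / δ - b := by
    have : 2 * K / δ = K / δ + K / δ := by ring
    linarith
  have hKδ : 0 < K / δ := div_pos hK hδ
  have h2 : (K / δ) ^ 2 ≤ (2 * K / δ - b) ^ 2 := by
    exact pow_le_pow_left₀ hKδ.le h1 2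
  have h3 : K < (K / δ) ^ 2 / (4 * a) := by
    rw [lt_div_iff₀ (by positivity), div_pow]
    rw [lt_div_iff₀ (by positivity)] at hsmall
    have hδ2 : 0 < δ ^ 2 := by positivity
    rw [lt_div_iff₀ hδ2]
    nlinarith
  calc K < (K / δ) ^ 2 / (4 * a) := h3
    _ ≤ (2 * K / δ - b) ^ 2 / (4 * a) := by gcongr

/-- AM–GM half of the (hypothetical) two-branch floor; also the shape of F21's cost optimisation `A/v² + v²/2 ≥ √(2A)`:
`K/λ + λ/(16a) ≥ 2√(K/(16a))`. [folklore] -/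
theorem dv_bound_floor {a K lam : ℝ} (ha : 0 < a) (hK : 0 < K) (hlam : 0 < lam) :
    2 * Real.sqrt (K / (16 * a)) ≤ K / lam + lam / (16 * a) := by
  have h16 : (0 : ℝ) < 16 * a := by positivity
  set x := K / lam with hxdef
  set y := lam / (16 * a) with hydef
  have hx : 0 ≤ x := (div_pos hK hlam).le
  have hy : 0 ≤ y := (div_pos hlam h16).le
  have hprod : K / (16 * a) = x * y := by
    rw [hxdef, hydef]; field_simp
  rw [hprod, Real.sqrt_mul hx]
  nlinarith [sq_nonneg (Real.sqrt x - Real.sqrt y), Real.sq_sqrt hx, Real.sq_sqrt hy,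
    Real.sqrt_nonneg x, Real.sqrt_nonneg y]

/-- The regime remark made precise: for `2b ≤ λ`, `(λ − b)²/(4aλ) ≥ λ/(16a)`. [folklore] -/
theorem necklace_term_ge {a b lam : ℝ} (ha : 0 < a) (hlam : 2 * b ≤ lam) (hlam0 : 0 < lam) :
    lam / (16 * a) ≤ (lam - b) ^ 2 / (4 * a * lam) := by
  rw [div_le_div_iff₀ (by positivity) (by positivity)]
  nlinarith [sq_nonneg (lam - 2 * b), mul_pos ha hlam0]

/-- **Two-branch floor for a hypothetical extensive-cost family** (no instance on this crux after the retraction of F20): for every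
rate `λ > 0`, `h/λ + (λ − b)₊²/(4aλ) ≥ min (h/(2b)) (2√(h/(16a)))` — small rates pay the entropy, large rates pay the family.
[folklore] -/
theorem dv_floor_two_branch {a b h lam : ℝ} (ha : 0 < a) (hb : 0 < b) (hh : 0 < h) (hlam : 0 < lam) :
    min (h / (2 * b)) (2 * Real.sqrt (h / (16 * a))) ≤ h / lam + (max (lam - b) 0) ^ 2 / (4 * a * lam) := by
  rcases le_or_gt lam (2 * b) with hle | hlt
  · refine min_le_of_left_le ?_
    have h1 : h / (2 * b) ≤ h / lam := by
      apply div_le_div_of_nonneg_left hh.le hlam hle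
    have h2 : 0 ≤ (max (lam - b) 0) ^ 2 / (4 * a * lam) := by positivity
    linarith
  · refine min_le_of_right_le ?_
    have hmax : max (lam - b) 0 = lam - b := max_eq_left (by linarith)
    rw [hmax]
    have h1 := necklace_term_ge (b := b) ha hlt.le hlam
    have h2 := dv_bound_floor ha hh hlam
    linarith


end Summit.AtomisticToContinuum.HydrodynamicLimit.Theorems.PercolationClosesChaos.Negative

end
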